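import Summits.QuantumFields.YangMills.Theorems.FluctuationComparisonRegPrIntLS2BetaSupTowerOfLiftLadder
import HarnessLib

/-!
# S2β · AVG₂♭-ax_q, THE SUP CHAIN, FILE 3b — THE THREE-SUPPLIER EDITION OF THE LIFT-RECURSION KNIT: (ST) from (TOP-LAD) ∧ (LIFT-LAD) with the per-level source split
# `c_t = c₁ t + c₂ t + c₃ t` and THREE separate `L^t`-weighted budgets — (SCT-curl) (px13 g26 CURL-AVG ∘ px16 g22 (★) cell-maximal square function), (SCT-V) (px21 g24 (LIFT-V),
# px12 g25 (R1)-sup), (SCT-face∕Jensen) (px20 g23's TOP-JENSEN spine, px5 g23 Q11b) — each holder docks its own budget; the architecture of ✓p830137 is unchanged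

Cell `ym3-torus` (rung R3 — NOT d = 4, NOT infinite volume, NOT a mass gap, NOT Clay).  Width seat «width 17» `ym3-torus-px17` (gen 22); crux `stmt-QuantumFields-20520`, LINE g18-1 S2β.
`--kind proof --supports stmt-QuantumFields-20520 --as helper`, count-neutral, DEFINITION-FREE.  WHY: px21 g24 17:47:52Z «(V-LAD) separate or folded into (SCT-c)?», px20 g23 17:51:05Z
«c₀ = (B) + a FACE term», px13 g26 17:43∕17:55Z (curl part): the additive budget (SCT-c) of ✓p830137 splits linearly, so the three parts are SEPARATE HYPOTHESES here and nobody waits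
on a common `c`.  WHAT IS PROVED: ★★★`supTower_of_liftLadder₃` — ✓p830137 `supTower_of_liftLadder` at `c := c₁ + c₂ + c₃`, `C_c := C₁ + C₂ + C₃` (conclusion = the (ST) text at fixed
data VERBATIM with constant `2·(C₁ + C₂ + C₃)`).  INHABITATION (№100): LAW-FREE.  HONEST SCOPE: a 1-line algebraic corollary; (TOP-LAD)∕(LIFT-LAD)∕the three budgets∕(ST)∕LOC HYPOTHESES;
nothing of Bałaban's asserted or proved; GAP♯∘ (registry 3732b7df UNTOUCHED, 0∕5), S2β, 20520 ∕ 19936 ∕ 19200 ∕ `YM3TorusSU2` NOT proved; the Yang–Mills mass gap is NOT proved.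
-/

set_option autoImplicit false

noncomputable section

open scoped Matrix.Norms.L2Operator Topology RealInnerProductSpace Quaternion
open Set Function
open Literature.MathematicalPhysics.QuantumLattice (su2Quat)
open Literature.MathematicalPhysics.QuantumFieldTheory.Balaban1983to89
open Literature.MathematicalPhysics.QuantumFieldTheory.Balaban1983to89.T3ContinuumYM3Torus
open Literature.MathematicalPhysics.QuantumFieldTheory.Balaban1983to89.T3UnitLawDensityEML (ℰp)
open Literature.MathematicalPhysics.QuantumFieldTheory.Balaban1983to89.T3UnitScaleTilt
open Literature.MathematicalPhysics.QuantumFieldTheory.Balaban1983to89.T3TiltDescent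
open Literature.MathematicalPhysics.QuantumFieldTheory.Balaban1983to89.T3LevelShift
open Literature.MathematicalPhysics.QuantumFieldTheory.Balaban1983to89.ExpMeanLog (deltaSU)
open Literature.MathematicalPhysics.QuantumFieldTheory.Balaban1983to89.T4HaarSU2ExpChart (expPoint)
open Literature.MathematicalPhysics.QuantumFieldTheory.Balaban1983to89.T4ExpWindowSmallField (imVec logVec)
open Literature.MathematicalPhysics.QuantumFieldTheory.Balaban1983to89.T4Continuum

namespace Summit.QuantumFields.YangMills.Theorems.FluctuationComparisonRegPrIntLS2BetaSupTowerOfLiftLadderSplit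

open Summit.QuantumFields.YangMills.Theorems.FluctuationComparisonRegPrIntLS2BetaSupTowerOfLiftLadder (supTower_of_liftLadder)

variable {F : T3Family}

/-- ★★★ **(ST) AT FIXED DATA FROM (TOP-LAD) ∧ (LIFT-LAD) WITH A THREE-WAY SPLIT SOURCE `c = c₁ + c₂ + c₃` AND THREE SEPARATE BUDGETS** (curl ∕ transverse-`V` ∕ face-Jensen parts,
one per supplier); ✓p830137 `supTower_of_liftLadder` with `c := c₁ + c₂ + c₃`, `C_c := C₁ + C₂ + C₃`. [cite: Balaban1985Averaging, Prop. 4 (128)-(135) pp.37-38; Balaban1987RG1, (0.11) p.253] -/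
theorem supTower_of_liftLadder₃ {J K : ℕ} (hJK : J ≤ K) (θ : ℕ → ℝ) (U₀ : GaugeField (F.P K) 0 (Matrix.specialUnitaryGroup (Fin 2) ℂ)) (ζ : PBond (F.P K) 0 → EuclideanSpace ℝ (Fin 3))
    {A C₁ C₂ C₃ : ℝ} (c_c : ℝ) (hA : 0 ≤ A) (hAL : A * (F.L : ℝ) ≤ 1 / 2) (c₁ c₂ c₃ : ℕ → ℝ)
    (hTOP : ∀ h0 : 0 < K - J, (fun (t : ℕ) (ht : t < K - J) => ∑ B : PBond (F.P J) 0,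
            ‖(fun ℓ' : PBond (F.P (J + (t + 1))) 0 =>
              if ∃ b : PBond (F.P (J + t)) 0,
                ((B14.Eq22Determines.blockIter (J + t - J) b.src = (bondShift (F.sitesPerDir_eq (m := F.m) (K := J) (j := 0) (m' := F.m) (K' := J + t) (j' := J + t - J) (by omega)) B).src ∨ B14.Eq22Determines.blockIter (J + t - J) b.src = (bondShift (F.sitesPerDir_eq (m := F.m) (K := J) (j := 0) (m' := F.m) (K' := J + t) (j' := J + t - J) (by omega)) B).tgt) ∧
                (B14.Eq22Determines.blockIter (J + t - J) b.tgt = (bondShift (F.sitesPerDir_eq (m := F.m) (K := J) (j := 0) (m' := F.m) (K' := J + t) (j' := J + t - J) (by omega)) B).src ∨ B14.Eq22Determines.blockIter (J + t - J) b.tgt = (bondShift (F.sitesPerDir_eq (m := F.m) (K := J) (j := 0) (m' := F.m) (K' := J + t) (j' := J + t - J) (by omega)) B).tgt)) ∧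
                (blockOf ℓ'.src = (bondShift (F.sitesPerDir_eq (m := F.m) (K := J + t) (j := 0) (m' := F.m) (K' := J + t + 1) (j' := 1) (by omega)) b).src ∨ blockOf ℓ'.src = (bondShift (F.sitesPerDir_eq (m := F.m) (K := J + t) (j := 0) (m' := F.m) (K' := J + t + 1) (j' := 1) (by omega)) b).tgt)
              then logVec (su2Quat (descendTo F ℰp (J + (t + 1)) K (by omega) (fun ℓ => expPoint (ζ ℓ) * U₀ ℓ : GaugeField (F.P K) 0 (Matrix.specialUnitaryGroup (Fin 2) ℂ)) ℓ' * (descendTo F ℰp (J + (t + 1)) K (by omega) U₀ ℓ')⁻¹)) else 0)‖ ^ 2) 0 h0 ≤ (c₁ 0 + c₂ 0 + c₃ 0))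
    (hREC : ∀ (t : ℕ) (ht1 : t + 1 < K - J),
      (fun (t : ℕ) (ht : t < K - J) => ∑ B : PBond (F.P J) 0,
            ‖(fun ℓ' : PBond (F.P (J + (t + 1))) 0 =>
              if ∃ b : PBond (F.P (J + t)) 0,
                ((B14.Eq22Determines.blockIter (J + t - J) b.src = (bondShift (F.sitesPerDir_eq (m := F.m) (K := J) (j := 0) (m' := F.m) (K' := J + t) (j' := J + t - J) (by omega)) B).src ∨ B14.Eq22Determines.blockIter (J + t - J) b.src = (bondShift (F.sitesPerDir_eq (m := F.m) (K := J) (j := 0) (m' := F.m) (K' := J + t) (j' := J + t - J) (by omega)) B).tgt) ∧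
                (B14.Eq22Determines.blockIter (J + t - J) b.tgt = (bondShift (F.sitesPerDir_eq (m := F.m) (K := J) (j := 0) (m' := F.m) (K' := J + t) (j' := J + t - J) (by omega)) B).src ∨ B14.Eq22Determines.blockIter (J + t - J) b.tgt = (bondShift (F.sitesPerDir_eq (m := F.m) (K := J) (j := 0) (m' := F.m) (K' := J + t) (j' := J + t - J) (by omega)) B).tgt)) ∧
                (blockOf ℓ'.src = (bondShift (F.sitesPerDir_eq (m := F.m) (K := J + t) (j := 0) (m' := F.m) (K' := J + t + 1) (j' := 1) (by omega)) b).src ∨ blockOf ℓ'.src = (bondShift (F.sitesPerDir_eq (m := F.m) (K := J + t) (j := 0) (m' := F.m) (K' := J + t + 1) (j' := 1) (by omega)) b).tgt)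
              then logVec (su2Quat (descendTo F ℰp (J + (t + 1)) K (by omega) (fun ℓ => expPoint (ζ ℓ) * U₀ ℓ : GaugeField (F.P K) 0 (Matrix.specialUnitaryGroup (Fin 2) ℂ)) ℓ' * (descendTo F ℰp (J + (t + 1)) K (by omega) U₀ ℓ')⁻¹)) else 0)‖ ^ 2) (t + 1) ht1 ≤
        A * (fun (t : ℕ) (ht : t < K - J) => ∑ B : PBond (F.P J) 0,
            ‖(fun ℓ' : PBond (F.P (J + (t + 1))) 0 =>
              if ∃ b : PBond (F.P (J + t)) 0,
                ((B14.Eq22Determines.blockIter (J + t - J) b.src = (bondShift (F.sitesPerDir_eq (m := F.m) (K := J) (j := 0) (m' := F.m) (K' := J + t) (j' := J + t - J) (by omega)) B).src ∨ B14.Eq22Determines.blockIter (J + t - J) b.src = (bondShift (F.sitesPerDir_eq (m := F.m) (K := J) (j := 0) (m' := F.m) (K' := J + t) (j' := J + t - J) (by omega)) B).tgt) ∧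
                (B14.Eq22Determines.blockIter (J + t - J) b.tgt = (bondShift (F.sitesPerDir_eq (m := F.m) (K := J) (j := 0) (m' := F.m) (K' := J + t) (j' := J + t - J) (by omega)) B).src ∨ B14.Eq22Determines.blockIter (J + t - J) b.tgt = (bondShift (F.sitesPerDir_eq (m := F.m) (K := J) (j := 0) (m' := F.m) (K' := J + t) (j' := J + t - J) (by omega)) B).tgt)) ∧
                (blockOf ℓ'.src = (bondShift (F.sitesPerDir_eq (m := F.m) (K := J + t) (j := 0) (m' := F.m) (K' := J + t + 1) (j' := 1) (by omega)) b).src ∨ blockOf ℓ'.src = (bondShift (F.sitesPerDir_eq (m := F.m) (K := J + t) (j := 0) (m' := F.m) (K' := J + t + 1) (j' := 1) (by omega)) b).tgt)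
              then logVec (su2Quat (descendTo F ℰp (J + (t + 1)) K (by omega) (fun ℓ => expPoint (ζ ℓ) * U₀ ℓ : GaugeField (F.P K) 0 (Matrix.specialUnitaryGroup (Fin 2) ℂ)) ℓ' * (descendTo F ℰp (J + (t + 1)) K (by omega) U₀ ℓ')⁻¹)) else 0)‖ ^ 2) t (Nat.lt_of_succ_lt ht1) + (c₁ (t + 1) + c₂ (t + 1) + c₃ (t + 1)))
    (hSCT₁ : ∑ t ∈ Finset.range (K - J), (F.L : ℝ) ^ t * c₁ t ≤ C₁ * Real.exp (c_c * ∑ i ∈ Finset.range (K - J), (((5 * F.L : ℕ) : ℝ) ^ 2 / 4) * θ (K - i)) * (((F.L : ℝ)⁻¹) ^ (K - J) * ∑ ℓ : PBond (F.P K) 0, ‖ζ ℓ‖ ^ 2 +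
                (F.L : ℝ) ^ (K - J) * ∑ p : Plaq (F.P K) 0,
                  (1 - reTr ((GaugeField.plaqHol U₀ p)⁻¹ * GaugeField.plaqHol (fun ℓ => expPoint (ζ ℓ) * U₀ ℓ : GaugeField (F.P K) 0 (Matrix.specialUnitaryGroup (Fin 2) ℂ)) p))))
    (hSCT₂ : ∑ t ∈ Finset.range (K - J), (F.L : ℝ) ^ t * c₂ t ≤ C₂ * Real.exp (c_c * ∑ i ∈ Finset.range (K - J), (((5 * F.L : ℕ) : ℝ) ^ 2 / 4) * θ (K - i)) * (((F.L : ℝ)⁻¹) ^ (K - J) * ∑ ℓ : PBond (F.P K) 0, ‖ζ ℓ‖ ^ 2 +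
                (F.L : ℝ) ^ (K - J) * ∑ p : Plaq (F.P K) 0,
                  (1 - reTr ((GaugeField.plaqHol U₀ p)⁻¹ * GaugeField.plaqHol (fun ℓ => expPoint (ζ ℓ) * U₀ ℓ : GaugeField (F.P K) 0 (Matrix.specialUnitaryGroup (Fin 2) ℂ)) p))))
    (hSCT₃ : ∑ t ∈ Finset.range (K - J), (F.L : ℝ) ^ t * c₃ t ≤ C₃ * Real.exp (c_c * ∑ i ∈ Finset.range (K - J), (((5 * F.L : ℕ) : ℝ) ^ 2 / 4) * θ (K - i)) * (((F.L : ℝ)⁻¹) ^ (K - J) * ∑ ℓ : PBond (F.P K) 0, ‖ζ ℓ‖ ^ 2 +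
                (F.L : ℝ) ^ (K - J) * ∑ p : Plaq (F.P K) 0,
                  (1 - reTr ((GaugeField.plaqHol U₀ p)⁻¹ * GaugeField.plaqHol (fun ℓ => expPoint (ζ ℓ) * U₀ ℓ : GaugeField (F.P K) 0 (Matrix.specialUnitaryGroup (Fin 2) ℂ)) p)))) :
        ∑ t ∈ Finset.range (K - J), (if ht : t < K - J then
          (F.L : ℝ) ^ t * ∑ B : PBond (F.P J) 0,
            ‖(fun ℓ' : PBond (F.P (J + (t + 1))) 0 =>
              if ∃ b : PBond (F.P (J + t)) 0,
                ((B14.Eq22Determines.blockIter (J + t - J) b.src = (bondShift (F.sitesPerDir_eq (m := F.m) (K := J) (j := 0) (m' := F.m) (K' := J + t) (j' := J + t - J) (by omega)) B).src ∨ B14.Eq22Determines.blockIter (J + t - J) b.src = (bondShift (F.sitesPerDir_eq (m := F.m) (K := J) (j := 0) (m' := F.m) (K' := J + t) (j' := J + t - J) (by omega)) B).tgt) ∧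
                (B14.Eq22Determines.blockIter (J + t - J) b.tgt = (bondShift (F.sitesPerDir_eq (m := F.m) (K := J) (j := 0) (m' := F.m) (K' := J + t) (j' := J + t - J) (by omega)) B).src ∨ B14.Eq22Determines.blockIter (J + t - J) b.tgt = (bondShift (F.sitesPerDir_eq (m := F.m) (K := J) (j := 0) (m' := F.m) (K' := J + t) (j' := J + t - J) (by omega)) B).tgt)) ∧
                (blockOf ℓ'.src = (bondShift (F.sitesPerDir_eq (m := F.m) (K := J + t) (j := 0) (m' := F.m) (K' := J + t + 1) (j' := 1) (by omega)) b).src ∨ blockOf ℓ'.src = (bondShift (F.sitesPerDir_eq (m := F.m) (K := J + t) (j := 0) (m' := F.m) (K' := J + t + 1) (j' := 1) (by omega)) b).tgt)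
              then logVec (su2Quat (descendTo F ℰp (J + (t + 1)) K (by omega) (fun ℓ => expPoint (ζ ℓ) * U₀ ℓ : GaugeField (F.P K) 0 (Matrix.specialUnitaryGroup (Fin 2) ℂ)) ℓ' * (descendTo F ℰp (J + (t + 1)) K (by omega) U₀ ℓ')⁻¹)) else 0)‖ ^ 2
        else 0) ≤
      (2 * (C₁ + C₂ + C₃)) * Real.exp (c_c * ∑ i ∈ Finset.range (K - J), (((5 * F.L : ℕ) : ℝ) ^ 2 / 4) * θ (K - i)) * (((F.L : ℝ)⁻¹) ^ (K - J) * ∑ ℓ : PBond (F.P K) 0, ‖ζ ℓ‖ ^ 2 +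
                (F.L : ℝ) ^ (K - J) * ∑ p : Plaq (F.P K) 0,
                  (1 - reTr ((GaugeField.plaqHol U₀ p)⁻¹ * GaugeField.plaqHol (fun ℓ => expPoint (ζ ℓ) * U₀ ℓ : GaugeField (F.P K) 0 (Matrix.specialUnitaryGroup (Fin 2) ℂ)) p))) := by
  have hsum : ∑ t ∈ Finset.range (K - J), (F.L : ℝ) ^ t * (fun t => c₁ t + c₂ t + c₃ t) t ≤
      (C₁ + C₂ + C₃) * Real.exp (c_c * ∑ i ∈ Finset.range (K - J), (((5 * F.L : ℕ) : ℝ) ^ 2 / 4) * θ (K - i)) * (((F.L : ℝ)⁻¹) ^ (K - J) * ∑ ℓ : PBond (F.P K) 0, ‖ζ ℓ‖ ^ 2 +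
                (F.L : ℝ) ^ (K - J) * ∑ p : Plaq (F.P K) 0,
                  (1 - reTr ((GaugeField.plaqHol U₀ p)⁻¹ * GaugeField.plaqHol (fun ℓ => expPoint (ζ ℓ) * U₀ ℓ : GaugeField (F.P K) 0 (Matrix.specialUnitaryGroup (Fin 2) ℂ)) p))) := by
    have hsplit : ∑ t ∈ Finset.range (K - J), (F.L : ℝ) ^ t * (fun t => c₁ t + c₂ t + c₃ t) t =
        (∑ t ∈ Finset.range (K - J), (F.L : ℝ) ^ t * c₁ t) + (∑ t ∈ Finset.range (K - J), (F.L : ℝ) ^ t * c₂ t) +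
          ∑ t ∈ Finset.range (K - J), (F.L : ℝ) ^ t * c₃ t := by
      rw [← Finset.sum_add_distrib, ← Finset.sum_add_distrib]
      refine Finset.sum_congr rfl fun t _ => ?_
      ring
    rw [hsplit]
    have := add_le_add (add_le_add hSCT₁ hSCT₂) hSCT₃
    refine this.trans (le_of_eq ?_)
    ring
  exact supTower_of_liftLadder (F := F) hJK θ U₀ ζ c_c hA hAL (fun t => c₁ t + c₂ t + c₃ t) hTOP hREC hsum

end Summit.QuantumFields.YangMills.Theorems.FluctuationComparisonRegPrIntLS2BetaSupTowerOfLiftLadderSplit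

end
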